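import Literature.MathematicalPhysics.QuantumFieldTheory.CentralFunctionTransferKernel
import HarnessLib

/-!
# The class-averaged convolution-square kernel is a Gram kernel (gauge-boot, L3 supplement: 2D slab gluing 1/5)

HONEST FRAMING (cell `pub-gaugeboot`, page 1 of every file): the venture produces certified bounds
on lattice expectations at stated coupling, gauge group, dimension and torus size; NOT a mass gap,
NOT a continuum limit, NOT a string tension; NOT Yang–Mills-summit-bearing (barriers
`FixedCouplingUltralocality`, `PerturbativeInvisibility`). This module is group-theoretic
bookkeeping for the POSITIVE two-dimensional counterpart (`TiltedBoxOddAxisRPTwoDim.lean`) of the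
negative `TiltedBoxOddAxisRPNegative.lean`; it discharges nothing else.

Setting: a compact group `G` with Haar probability measure, a continuous weight `ψ : G → ℝ`
(in the application `ψ = ω^{⋆M}`, `ω = exp(β Re tr ρ)`). Objects (definitions):

* `featureMap ψ α u = ∫ ψ(y α y⁻¹ u⁻¹) dy` — the class average of `ψ(· u⁻¹)`, a REAL function;
* `slabKernel ψ α β = ∫ (ψ ⋆ ψ)(α x β⁻¹ x⁻¹) dx` — the class-averaged kernel of the convolution
  SQUARE (`haarConv` of `Literature.MathematicalPhysics.QuantumLattice`); in two-dimensional lattice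
  gauge theory this is what integrating the `2M` rungs of a one-plaquette-thick annulus of `2M`
  plaquettes leaves of the two boundary holonomies `α`, `β` (Migdal 1975; `SlabKernelChain.lean`).

Results (all `[folklore]`: Fubini and the invariances of Haar measure; no character expansion):

* `slabKernel_conj_right` / `featureMap_conj` — class invariance (`β ↦ c β c⁻¹`), no hypothesis on `ψ`;
* **`slabKernel_eq_integral_featureMap`** — for `ψ` continuous, CENTRAL and SYMMETRIC
  (`ψ(g⁻¹) = ψ(g)`): `slabKernel ψ α β = ∫ featureMap ψ α u · featureMap ψ β u du` — a Gram
  representation with a real feature map, whence `slabKernel ψ` is a kernel of positive type on ANY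
  measure space it is pulled back to (no positivity of `ψ` or of its Fourier coefficients is used:
  the number of convolution factors is EVEN);
* `integral_mul_conv_step` — the one-rung elimination identity
  `∫ φ(a z b⁻¹ v⁻¹) ω(A w B⁻¹ z⁻¹) dz = (ω ⋆ φ)(a A w B⁻¹ b⁻¹ v⁻¹)` for central `φ`, `ω`
  (the induction step of the annulus integral);
* `wilsonWt ρ β = exp(β Re tr ρ)` is continuous, central, symmetric, positive (compact `G`).

References: A. A. Migdal, Sov. Phys. JETP 42 (1975) 413 (recursion equations / 2D exact solution);
B. K. Driver, Commun. Math. Phys. 123 (1989) 575, §7; E. Seiler, LNP 159 (1982) Ch. 2;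
C. Berg, J. P. R. Christensen, P. Ressel, *Harmonic Analysis on Semigroups* (1984) Ch. 3 §1
(kernels of positive type).
-/

noncomputable section

open MeasureTheory Filter Function
open Literature.MathematicalPhysics.QuantumLattice
open Literature.MathematicalPhysics.QuantumFieldTheory (haarProbability integral_haar_conj_eq)
open Literature.MathematicalPhysics.QuantumFieldTheory.CentralKernel (central_haarConv symm_haarConv
  central_haarConv_iterate symm_haarConv_iterate)
open Literature.RepresentationTheory.CompactGroups

namespace Summit.QuantumFields.GaugeBoot

namespace SlabKernel

variable {G : Type*} [Group G] [TopologicalSpace G] [IsTopologicalGroup G] [CompactSpace G]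
  [MeasurableSpace G] [BorelSpace G]

/-! ## The Wilson weight `exp(β Re tr ρ)` -/

section Weight

variable {N : ℕ} (ρ : G →* Matrix (Fin N) (Fin N) ℂ)

/-- The one-plaquette Wilson weight `ω_β(g) = exp(β Re tr ρ(g))`. -/
def wilsonWt (β : ℝ) (g : G) : ℝ := Real.exp (β * (ρ g).trace.re)

omit [IsTopologicalGroup G] [CompactSpace G] [MeasurableSpace G] [BorelSpace G] in
/-- The Wilson weight is continuous. [folklore] -/
theorem continuous_wilsonWt (hρ : Continuous ρ) (β : ℝ) : Continuous (wilsonWt ρ β) :=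
  Real.continuous_exp.comp (continuous_const.mul
    (Complex.continuous_re.comp ((Matrix.continuous_trace).comp hρ)))
  where Matrix.continuous_trace : Continuous (Matrix.trace : Matrix (Fin N) (Fin N) ℂ → ℂ) :=
    continuous_finsetSum _ fun i _ => (continuous_apply i).comp (continuous_apply i)

omit [TopologicalSpace G] [IsTopologicalGroup G] [CompactSpace G] [MeasurableSpace G] [BorelSpace G] in
/-- The Wilson weight is positive. [folklore] -/
theorem wilsonWt_pos (β : ℝ) (g : G) : 0 < wilsonWt ρ β g := Real.exp_pos _

omit [TopologicalSpace G] [IsTopologicalGroup G] [CompactSpace G] [MeasurableSpace G] [BorelSpace G] in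
/-- The Wilson weight is a class function. [folklore] -/
theorem wilsonWt_central (β : ℝ) (g h : G) : wilsonWt ρ β (h * g * h⁻¹) = wilsonWt ρ β g := by
  rw [wilsonWt, wilsonWt, CompactGroup.trace_conj_eq]

omit [MeasurableSpace G] [BorelSpace G] in
/-- The Wilson weight is symmetric under inversion (compact `G`: `tr ρ(g⁻¹) = conj tr ρ(g)`).
[folklore] -/
theorem wilsonWt_inv (hρ : Continuous ρ) (β : ℝ) (g : G) : wilsonWt ρ β g⁻¹ = wilsonWt ρ β g := by
  rw [wilsonWt, wilsonWt, CompactGroup.re_trace_map_inv ρ hρ]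

end Weight

/-! ## Continuity of parametric Haar integrals -/

/-- A parametric Haar integral of a jointly continuous integrand on a compact parameter space is
continuous in the parameter (dominated convergence with a constant bound). [folklore] -/
theorem continuous_integral_of_continuous {X : Type*} [TopologicalSpace X] [FirstCountableTopology X]
    [CompactSpace X] {F : X → G → ℝ} (hF : Continuous (uncurry F)) :
    Continuous fun x => ∫ y, F x y ∂haarProbability G := by
  obtain ⟨B, hB⟩ := isCompact_univ.exists_bound_of_continuousOn hF.continuousOn
  refine continuous_of_dominated (bound := fun _ => B) (fun x => ?_) (fun x => ?_) (integrable_const B)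
    (Eventually.of_forall fun y => ?_)
  · exact (hF.comp (Continuous.prodMk continuous_const continuous_id)).aestronglyMeasurable
  · exact Eventually.of_forall fun y => hB (x, y) (Set.mem_univ _)
  · exact hF.comp (Continuous.prodMk continuous_id continuous_const)

/-! ## The feature map and the slab kernel -/

/-- **The feature map** `e_ψ(α, u) = ∫ ψ(y α y⁻¹ u⁻¹) dy` (class average of `ψ(· u⁻¹)`). -/
def featureMap (ψ : G → ℝ) (α u : G) : ℝ := ∫ y, ψ (y * α * y⁻¹ * u⁻¹) ∂haarProbability G

/-- **The slab kernel** `k_ψ(α, β) = ∫ (ψ ⋆ ψ)(α x β⁻¹ x⁻¹) dx` (class-averaged convolution square). -/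
def slabKernel (ψ : G → ℝ) (α β : G) : ℝ :=
  ∫ x, haarConv ψ ψ (α * x * β⁻¹ * x⁻¹) ∂haarProbability G

/-- Class invariance of the feature map: `e(c α c⁻¹, u) = e(α, u)` (right invariance `y ↦ y c`).
[folklore] -/
theorem featureMap_conj (ψ : G → ℝ) (c α u : G) : featureMap ψ (c * α * c⁻¹) u = featureMap ψ α u := by
  unfold featureMap
  rw [← integral_mul_right_eq_self (fun y => ψ (y * α * y⁻¹ * u⁻¹)) c]
  refine integral_congr_ae (Eventually.of_forall fun y => ?_)
  dsimp only
  congr 1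
  group

/-- Class invariance of the slab kernel in the second argument: `k(α, c β c⁻¹) = k(α, β)`
(right invariance `x ↦ x c`; no hypothesis on `ψ`). [folklore] -/
theorem slabKernel_conj_right (ψ : G → ℝ) (c α β : G) :
    slabKernel ψ α (c * β * c⁻¹) = slabKernel ψ α β := by
  unfold slabKernel
  rw [← integral_mul_right_eq_self (fun x => haarConv ψ ψ (α * x * β⁻¹ * x⁻¹)) c]
  refine integral_congr_ae (Eventually.of_forall fun x => ?_)
  dsimp only
  congr 1
  group

/-- Class invariance of the slab kernel in the first argument: `k(c α c⁻¹, β) = k(α, β)`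
(left invariance `x ↦ c⁻¹ x` and centrality of `ψ ⋆ ψ`). [folklore] -/
theorem slabKernel_conj_left {ψ : G → ℝ} (hψ : ∀ g h, ψ (h * g * h⁻¹) = ψ g) (c α β : G) :
    slabKernel ψ (c * α * c⁻¹) β = slabKernel ψ α β := by
  unfold slabKernel
  rw [← integral_mul_left_eq_self (fun x => haarConv ψ ψ (α * x * β⁻¹ * x⁻¹)) c⁻¹]
  refine integral_congr_ae (Eventually.of_forall fun x => ?_)
  dsimp only
  have hc := central_haarConv hψ hψ (α * (c⁻¹ * x) * β⁻¹ * (c⁻¹ * x)⁻¹) c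
  rw [← hc]
  congr 1
  group

/-- The feature map is bounded by the sup of `|ψ|`. [folklore] -/
theorem abs_featureMap_le {ψ : G → ℝ} {C : ℝ} (hC : ∀ g, |ψ g| ≤ C) (α u : G) : |featureMap ψ α u| ≤ C := by
  unfold featureMap
  refine (abs_integral_le_integral_abs).trans ?_
  calc ∫ y, |ψ (y * α * y⁻¹ * u⁻¹)| ∂haarProbability G ≤ ∫ _y, C ∂haarProbability G :=
        integral_mono_of_nonneg (Eventually.of_forall fun _ => abs_nonneg _) (integrable_const C)
          (Eventually.of_forall fun y => hC _)
    _ = C := by simp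

variable [SecondCountableTopology G]

/-- The feature map is jointly continuous. [folklore] -/
theorem continuous_uncurry_featureMap {ψ : G → ℝ} (hψ : Continuous ψ) : Continuous (uncurry (featureMap ψ)) := by
  have hF : Continuous (uncurry fun (p : G × G) (y : G) => ψ (y * p.1 * y⁻¹ * p.2⁻¹)) :=
    hψ.comp ((((continuous_snd.mul (continuous_fst.comp continuous_fst)).mul continuous_snd.inv)).mul
      (continuous_snd.comp continuous_fst).inv)
  exact continuous_integral_of_continuous hF

/-- The feature map is continuous in `u`. [folklore] -/
theorem continuous_featureMap_right {ψ : G → ℝ} (hψ : Continuous ψ) (α : G) : Continuous (featureMap ψ α) :=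
  (continuous_uncurry_featureMap hψ).comp (Continuous.prodMk continuous_const continuous_id)

/-- The feature map is continuous in `α`. [folklore] -/
theorem continuous_featureMap_left {ψ : G → ℝ} (hψ : Continuous ψ) (u : G) :
    Continuous fun α => featureMap ψ α u :=
  (continuous_uncurry_featureMap hψ).comp (Continuous.prodMk continuous_id continuous_const)

/-! ## The Gram identity -/

omit [SecondCountableTopology G] in
/-- The convolution square at `g h⁻¹`, for symmetric `ψ`:
`(ψ ⋆ ψ)(g h⁻¹) = ∫ ψ(g u⁻¹) ψ(h u⁻¹) du`. [folklore] -/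
theorem haarConv_self_apply_mul_inv {ψ : G → ℝ} (hψi : ∀ g, ψ g⁻¹ = ψ g) (g h : G) :
    haarConv ψ ψ (g * h⁻¹) = ∫ u, ψ (g * u⁻¹) * ψ (h * u⁻¹) ∂haarProbability G := by
  rw [haarConv_eq_integral_mul_inv,
    ← integral_mul_right_eq_self (fun u => ψ (g * h⁻¹ * u⁻¹) * ψ u) h⁻¹]
  refine integral_congr_ae (Eventually.of_forall fun u => ?_)
  dsimp only
  rw [mul_inv_rev, inv_inv, ← mul_assoc, inv_mul_cancel_right, ← hψi (u * h⁻¹), mul_inv_rev, inv_inv]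

omit [SecondCountableTopology G] in
/-- The double class average: `∫ f(α x β⁻¹ x⁻¹) dx = ∫∫ f((y α y⁻¹)(z β z⁻¹)⁻¹) dz dy` for central
`f`. [folklore] -/
theorem integral_central_conj_eq_double {f : G → ℝ} (hf : ∀ g h, f (h * g * h⁻¹) = f g) (α β : G) :
    ∫ x, f (α * x * β⁻¹ * x⁻¹) ∂haarProbability G =
      ∫ y, ∫ z, f (y * α * y⁻¹ * (z * β * z⁻¹)⁻¹) ∂haarProbability G ∂haarProbability G := by
  have hin : ∀ y, ∫ z, f (y * α * y⁻¹ * (z * β * z⁻¹)⁻¹) ∂haarProbability G =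
      ∫ x, f (α * x * β⁻¹ * x⁻¹) ∂haarProbability G := fun y => by
    rw [← integral_mul_left_eq_self (fun x => f (α * x * β⁻¹ * x⁻¹)) y⁻¹]
    refine integral_congr_ae (Eventually.of_forall fun z => ?_)
    dsimp only
    rw [← hf (α * (y⁻¹ * z) * β⁻¹ * (y⁻¹ * z)⁻¹) y]
    congr 1
    group
  simp_rw [hin]
  simp

/-- **The Gram identity.** For `ψ` continuous, central and symmetric,
`k_ψ(α, β) = ∫ e_ψ(α, u) e_ψ(β, u) du`. [folklore] -/
theorem slabKernel_eq_integral_featureMap {ψ : G → ℝ} (hψc : Continuous ψ)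
    (hψ : ∀ g h, ψ (h * g * h⁻¹) = ψ g) (hψi : ∀ g, ψ g⁻¹ = ψ g) (α β : G) :
    slabKernel ψ α β = ∫ u, featureMap ψ α u * featureMap ψ β u ∂haarProbability G := by
  unfold slabKernel
  rw [integral_central_conj_eq_double (central_haarConv hψ hψ)]
  simp_rw [haarConv_self_apply_mul_inv hψi]
  -- now: `∫_y ∫_z ∫_u ψ((yαy⁻¹)u⁻¹) ψ((zβz⁻¹)u⁻¹) = ∫_u (∫_y …)(∫_z …)`
  have hcont3 : Continuous fun p : G × G × G =>
      ψ (p.1 * α * p.1⁻¹ * p.2.2⁻¹) * ψ (p.2.1 * β * p.2.1⁻¹ * p.2.2⁻¹) := by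
    refine (hψc.comp ?_).mul (hψc.comp ?_)
    · exact ((continuous_fst.mul continuous_const).mul continuous_fst.inv).mul
        (continuous_snd.comp continuous_snd).inv
    · exact (((continuous_fst.comp continuous_snd).mul continuous_const).mul
        (continuous_fst.comp continuous_snd).inv).mul (continuous_snd.comp continuous_snd).inv
  -- inner swap `z ↔ u`
  have hswap1 : ∀ y, ∫ z, ∫ u, ψ (y * α * y⁻¹ * u⁻¹) * ψ (z * β * z⁻¹ * u⁻¹) ∂haarProbability G
      ∂haarProbability G = ∫ u, ψ (y * α * y⁻¹ * u⁻¹) * featureMap ψ β u ∂haarProbability G := fun y => by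
    rw [integral_integral_swap]
    · refine integral_congr_ae (Eventually.of_forall fun u => ?_)
      simp only [featureMap, ← integral_const_mul]
    · exact (hcont3.comp (Continuous.prodMk continuous_const continuous_id)).integrable_of_hasCompactSupport
        (HasCompactSupport.of_compactSpace _)
  simp_rw [hswap1]
  -- outer swap `y ↔ u`
  rw [integral_integral_swap]
  · refine integral_congr_ae (Eventually.of_forall fun u => ?_)
    simp only [featureMap, ← integral_mul_const]
  · have hc : Continuous fun p : G × G => ψ (p.1 * α * p.1⁻¹ * p.2⁻¹) * featureMap ψ β p.2 :=
      (hψc.comp (((continuous_fst.mul continuous_const).mul continuous_fst.inv).mul continuous_snd.inv)).mul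
        ((continuous_featureMap_right hψc β).comp continuous_snd)
    exact hc.integrable_of_hasCompactSupport (HasCompactSupport.of_compactSpace _)

/-- **The slab kernel is of positive type on every measure space it is pulled back to**: for a finite
measure `ν`, bounded measurable `Φ : Ω → ℂ` and measurable `a : Ω → G`,
`∫∫ Φ(w) conj Φ(w') k_ψ(a w, a w') dν dν = ∫ |∫ Φ(w) e_ψ(a w, u) dν(w)|² du ≥ 0` — recorded as the real
part statement `0 ≤ Re ∫∫ …` with vanishing imaginary part is not needed downstream; we record the
Fubini form used by the lattice assembly: `∫ Φ₁ Φ₂ k(a, b) dν = ∫ (∫ Φ₁ e(a,u) · Φ₂ e(b,u) dν) du`.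
[folklore] -/
theorem integral_mul_slabKernel_eq {Ω : Type*} [MeasurableSpace Ω] (ν : Measure Ω) [IsFiniteMeasure ν]
    {ψ : G → ℝ} (hψc : Continuous ψ) (hψ : ∀ g h, ψ (h * g * h⁻¹) = ψ g) (hψi : ∀ g, ψ g⁻¹ = ψ g)
    {Φ : Ω → ℂ} (hΦm : Measurable Φ) {K : ℝ} (hΦb : ∀ w, ‖Φ w‖ ≤ K)
    {a b : Ω → G} (ha : Measurable a) (hb : Measurable b) :
    ∫ w, Φ w * (slabKernel ψ (a w) (b w) : ℂ) ∂ν =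
      ∫ u, ∫ w, Φ w * ((featureMap ψ (a w) u : ℂ) * (featureMap ψ (b w) u : ℂ)) ∂ν ∂haarProbability G := by
  simp_rw [slabKernel_eq_integral_featureMap hψc hψ hψi]
  obtain ⟨C, -, hC⟩ := exists_forall_abs_le_of_continuous hψc
  have hjoint : Continuous fun p : G × G × G => featureMap ψ p.1 p.2.2 * featureMap ψ p.2.1 p.2.2 :=
    ((continuous_uncurry_featureMap hψc).comp (continuous_fst.prodMk (continuous_snd.comp continuous_snd))).mul
      ((continuous_uncurry_featureMap hψc).comp
        ((continuous_fst.comp continuous_snd).prodMk (continuous_snd.comp continuous_snd)))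
  have hFm : Measurable fun q : Ω × G => Φ q.1 * ((featureMap ψ (a q.1) q.2 : ℂ) * (featureMap ψ (b q.1) q.2 : ℂ)) := by
    refine (hΦm.comp measurable_fst).mul ?_
    have h2 : Measurable fun q : Ω × G => featureMap ψ (a q.1) q.2 * featureMap ψ (b q.1) q.2 :=
      hjoint.measurable.comp ((ha.comp measurable_fst).prodMk ((hb.comp measurable_fst).prodMk measurable_snd))
    simpa only [Function.comp_def, Complex.ofReal_mul] using Complex.measurable_ofReal.comp h2
  have hFb : ∀ q : Ω × G, ‖Φ q.1 * ((featureMap ψ (a q.1) q.2 : ℂ) * (featureMap ψ (b q.1) q.2 : ℂ))‖ ≤ K * (C * C) :=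
    fun q => by
      rw [norm_mul, norm_mul, Complex.norm_real, Complex.norm_real, Real.norm_eq_abs, Real.norm_eq_abs]
      have hK : 0 ≤ K := (norm_nonneg _).trans (hΦb q.1)
      have h1 : |featureMap ψ (a q.1) q.2| ≤ C := abs_featureMap_le hC _ _
      have h2 : |featureMap ψ (b q.1) q.2| ≤ C := abs_featureMap_le hC _ _
      have hC0 : 0 ≤ C := (abs_nonneg _).trans h1
      exact mul_le_mul (hΦb _) (mul_le_mul h1 h2 (abs_nonneg _) hC0) (by positivity) hK
  have hint : Integrable (fun q : Ω × G => Φ q.1 * ((featureMap ψ (a q.1) q.2 : ℂ) * (featureMap ψ (b q.1) q.2 : ℂ)))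
      (ν.prod (haarProbability G)) :=
    Integrable.of_bound hFm.aestronglyMeasurable (K * (C * C)) (Eventually.of_forall hFb)
  rw [← integral_integral_swap hint]
  refine integral_congr_ae (Eventually.of_forall fun w => ?_)
  dsimp only
  rw [← integral_complex_ofReal, ← integral_const_mul]
  refine integral_congr_ae (Eventually.of_forall fun u => ?_)
  simp only [Complex.ofReal_mul]

/-! ## The one-rung elimination identity -/

omit [SecondCountableTopology G] in
/-- **One rung**: for central `φ`, `ω`,
`∫ φ(a z b⁻¹ v⁻¹) ω(A w B⁻¹ z⁻¹) dz = (ω ⋆ φ)(a A w B⁻¹ b⁻¹ v⁻¹)`. [folklore] -/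
theorem integral_mul_conv_step {φ ω : G → ℝ} (hφ : ∀ g h, φ (h * g * h⁻¹) = φ g)
    (hω : ∀ g h, ω (h * g * h⁻¹) = ω g) (a b v A B w : G) :
    ∫ z, φ (a * z * b⁻¹ * v⁻¹) * ω (A * w * B⁻¹ * z⁻¹) ∂haarProbability G =
      haarConv ω φ (a * A * w * B⁻¹ * b⁻¹ * v⁻¹) := by
  -- central functions satisfy `f(X Y) = f(Y X)`
  have hφc : ∀ X Y, φ (X * Y) = φ (Y * X) := fun X Y => by
    have h := hφ (X * Y) Y
    rw [← mul_assoc, mul_inv_cancel_right] at h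
    exact h.symm
  have hωc : ∀ X Y, ω (X * Y) = ω (Y * X) := fun X Y => by
    have h := hω (X * Y) Y
    rw [← mul_assoc, mul_inv_cancel_right] at h
    exact h.symm
  -- `φ(a z b⁻¹ v⁻¹) = φ(z c)`, `c = b⁻¹ v⁻¹ a`; `ω(A w B⁻¹ z⁻¹) = ω(z⁻¹ D)`, `D = A w B⁻¹`
  have h1 : ∀ z, φ (a * z * b⁻¹ * v⁻¹) = φ (z * (b⁻¹ * v⁻¹ * a)) := fun z => by
    rw [show a * z * b⁻¹ * v⁻¹ = a * (z * b⁻¹ * v⁻¹) by simp only [mul_assoc], hφc]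
    simp only [mul_assoc]
  have h2 : ∀ z, ω (A * w * B⁻¹ * z⁻¹) = ω (z⁻¹ * (A * w * B⁻¹)) := fun z => hωc _ _
  simp_rw [h1, h2]
  rw [show a * A * w * B⁻¹ * b⁻¹ * v⁻¹ = a * ((A * w * B⁻¹) * (b⁻¹ * v⁻¹ * a)) * a⁻¹ by group,
    central_haarConv hω hφ, haarConv_eq_integral_mul_inv,
    ← integral_mul_right_eq_self (fun h => ω (A * w * B⁻¹ * (b⁻¹ * v⁻¹ * a) * h⁻¹) * φ h)
      (b⁻¹ * v⁻¹ * a)]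
  refine integral_congr_ae (Eventually.of_forall fun z => ?_)
  dsimp only
  rw [mul_comm, hωc]
  congr 2
  group

end SlabKernel

end Summit.QuantumFields.GaugeBoot

end
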